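import Summits.QuantumFields.BalabanUV.T4Continuum.Support.NE3SpreadLiftCurlCorner
import Summits.QuantumFields.BalabanUV.T4Continuum.Support.NE3SliceLiftCurl
import Summits.QuantumFields.BalabanUV.T4Continuum.Support.NE3EnergyHessContTwoTerm
import Summits.QuantumFields.BalabanUV.T4Continuum.Support.AveragingDeficitDualResidual
import HarnessLib

/-!
# T⁴ programme, node NE3 — row E-RES♯, sub-row (R♯3b) «DRESSED SLICE LIFT — CURL», file 3: THE `ℓ²` ASSEMBLY OVER THE
# PERIOD TORUS — THE END `sqrt_curlSq_spreadLift_le` AND ITS `dirSq` ∕ `dirL1` ∕ `curlL1` COMPANIONS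

NE3 (node U1b) formalisation swarm `b2b-balaban-t4-ne3-formalise-*`, leaf seat `b2b-balaban-t4-ne3-formalise-leaf-01`
(gen 4), row **E-RES♯ (R♯3b)** (owner CUT journal l.14429; FINDING F-ne3leaf01g4-1; SHAPE
`HOME/t4/formal/NE3/Statements/E-RES-R3b-SHAPE-v1.md`; END-SIGNATURE l.14898).  Files 1∕2 = `NE3SpreadLiftCurlLocal` (p220820),
`NE3SpreadLiftCurlCorner` (p221131).

WHAT.  For `L ≥ 1`, `M ≥ 1`, `d ≥ 2`, a unitary fine background `V ∈ SmallField V a` with the standard smallness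
`512(d+1)(d+4)L²a ≤ 1`, and an `M`-periodic coarse direction `φ`, the spread lift `ψ = spreadLift L V φ` satisfies, over one
period `[0, L·M)^d` of the fine torus (THIS FILE, 0 `def`, 0 `sorry`):

* **`sqrt_curlSq_spreadLift_le`** (THE END of (R♯3b)):
  `√(curlSq V ψ (periodBox (L·M))) ≤ √(L^{d−2})·√(curlSq (cavg L V) φ (periodBox M)) + 2048(d+4)²L²√(d·L^d)·a·√(dirSq φ (periodBox M))`
  — plaquette by plaquette `‖(d_V ψ)(x;π)‖ ≤ [corner]·‖(d_{V̄} φ)(cdiv x; π)‖ + K·G` (files 1∕2, `K = 2((8dL)²a + 12·loopRad) ≤ 512(d+4)²L²a`,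
  `G` = the four coarse bond norms of the coarse plaquette), finite Minkowski (`NE3EnergyHessContTwoTerm.sqrt_sum_sq_add_le`),
  the corner count `L^{d−2}` per block and plane (`NE3SliceLiftCurl.sum_cornerInd`) and `Σ G² ≤ 16·d·L^d·dirSq φ` (periodic shifts);
* `dirSq_spreadLift` ∕ `dirL1_spreadLift`: `= L^{d−1}·dirSq φ` ∕ `= L^{d−1}·dirL1 φ` EXACTLY (the dressings are unitary conjugations);
* `curlL1_spreadLift_le`: `curlL1 V ψ (periodBox (L·M)) ≤ 8·d·L^d·dirL1 φ (periodBox M)`.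
These are the hypothesis shapes `hcurl` ∕ `hdirL1` ∕ `hcurlL1` of the (R♯5) socket (leaf-02-g4, `Statements/E-RES-R5-SHAPE-v1.md`)
at `lift := spreadLift L U_B`, `c₁ = √(L^{d−2})`, `c₂ = 2048(d+4)²L²√(d·L^d)`, `c₃ = L^{d−1}`, `c₄ = 8dL^d`.

HONEST FRAMING.  Kinematics of ONE averaging step at ONE background (our frame; [folklore]; context [Balaban1985Averaging]
(47)–(50) p. 25); nothing about Bałaban's minimisers; (RES♯) NOT proved here (its assembly (R♯5) is another seat's); **NE3 is NOT
proved**; spine PROVED 0∕9; finite T⁴ rung (B)+1 — NOT infinite volume, NOT mass gap, NOT `BetaPertH`, NOT Clay.  PLACEMENT: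
`Summits/QuantumFields/BalabanUV/`; imports files 1∕2, `NE3SliceLiftCurl` (p220084: the slice counts), `NE3EnergyHessContTwoTerm`
(finite Minkowski), `AveragingDeficitDualResidual` (`norm_curl_le_four`) BY NAME.  HONEST DEPENDENCY (cell page 1): continuum YM on
T⁴ ⇐ BetaPertH ∧ nine spine estimates (0/9 proved); BetaPertH ⇐ (D1) ∧ (D4) ∧ CAP+tail; G-an2-4 gates asym, D1 and NE2/3/4.
-/

set_option autoImplicit false

open scoped BigOperators Matrix Matrix.Norms.L2Operator

namespace Summit.QuantumFields.BalabanUV.T4Continuum.NE3SpreadLiftCurl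

open Literature.MathematicalPhysics.QuantumFieldTheory.Balaban1983to89
open B7Prop1Explicit B7Prop2Explicit
open T4AveragingDeficitWall hiding Site Plane Plaq Bond
open T4AveragingDeficitWallBoundary (periodBox blockSites_periodBox sum_blocks_eq sum_periodBox_shift)
open AveragingDeficitTransport (norm_Ad_of_unitary)
open AveragingDeficitChartCalculus (cavg)
open AveragingDeficitPeriodicCounting (IsPeriodicDir)
open AveragingDeficitDualResidual (norm_curl_le_four)
open SkeletonLattice (cdiv cmod)
open SpreadLiftWords (IsCross isCross_smul_add_boxVec_iff cdiv_smul_add_boxVec)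
open SpreadLift (loopRad)
open SpreadLiftDirection (spreadLift spreadLift_of_isCross crossSupported_spreadLift crossHol_mem)
open AveragingDeficitBlockDensity (cavg_mem card_offsets_real)
open NE3SliceLiftCurl (sum_cornerInd sum_sliceInd)
open NE3EnergyHessContTwoTerm (sqrt_sum_sq_add_le sqrt_sum_sq_mono)
open NE3SpreadLiftCurlLocal (norm_curlAt_spreadLift_le_of_not_corner)
open NE3SpreadLiftCurlCorner (norm_curlAt_spreadLift_corner_le)

noncomputable section

variable {d : ℕ} {n : Type*} [Fintype n] [DecidableEq n]

/-! ## §1 Bond norms of the spread lift: `dirSq`, `dirL1` exactly -/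

/-- `‖ψ(x, i)‖ = [crossing]·‖φ(cdiv x, i)‖`: the dressing is a unitary conjugation. [folklore] -/
theorem norm_spreadLift_eq [Nonempty n] (L : ℕ) {V : Site d → Fin d → (Matrix n n ℂ)ˣ} (hV : IsUnitaryCfg V)
    (φ : Site d → Fin d → Matrix n n ℂ) (x : Site d) (i : Fin d) :
    ‖spreadLift L V φ x i‖ = if IsCross L x i then ‖φ (cdiv L x) i‖ else 0 := by
  by_cases h : IsCross L x i
  · rw [if_pos h, spreadLift_of_isCross L V φ h, norm_Ad_of_unitary ((unitaryUnits _).inv_mem (crossHol_mem L hV x i))]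
  · rw [if_neg h, crossSupported_spreadLift L V φ x i h, norm_zero]

/-- **`dirSq (spreadLift L V φ) (periodBox (L·M)) = L^{d−1}·dirSq φ (periodBox M)`** (`L ≥ 1`, unitary `V`). [folklore] -/
theorem dirSq_spreadLift [Nonempty n] {L : ℕ} (hL : 1 ≤ L) {V : Site d → Fin d → (Matrix n n ℂ)ˣ} (hV : IsUnitaryCfg V) (M : ℕ)
    (φ : Site d → Fin d → Matrix n n ℂ) :
    dirSq (spreadLift L V φ) (periodBox (L * M)) = (L : ℝ) ^ (d - 1) * dirSq φ (periodBox M) := by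
  unfold dirSq
  rw [← blockSites_periodBox L M hL, ← sum_blocks_eq L hL (periodBox M), Finset.mul_sum]
  refine Finset.sum_congr rfl fun z _ => ?_
  have hE : ∀ r : Fin d → Fin L, ∑ κ : Fin d, ‖spreadLift L V φ ((L : ℤ) • z + boxVec L r) κ‖ ^ 2
      = ∑ κ : Fin d, (if ((r κ : ℕ) : ℤ) = (L : ℤ) - 1 then ‖φ z κ‖ ^ 2 else 0) := by
    intro r
    refine Finset.sum_congr rfl fun κ _ => ?_
    rw [norm_spreadLift_eq L hV, cdiv_smul_add_boxVec]
    simp only [isCross_smul_add_boxVec_iff]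
    split_ifs <;> simp
  simp_rw [hE]
  rw [Finset.sum_comm]
  simp_rw [sum_sliceInd hL]
  rw [← Finset.mul_sum]

/-- **`dirL1 (spreadLift L V φ) (periodBox (L·M)) = L^{d−1}·dirL1 φ (periodBox M)`** (`L ≥ 1`, unitary `V`). [folklore] -/
theorem dirL1_spreadLift [Nonempty n] {L : ℕ} (hL : 1 ≤ L) {V : Site d → Fin d → (Matrix n n ℂ)ˣ} (hV : IsUnitaryCfg V) (M : ℕ)
    (φ : Site d → Fin d → Matrix n n ℂ) :
    dirL1 (spreadLift L V φ) (periodBox (L * M)) = (L : ℝ) ^ (d - 1) * dirL1 φ (periodBox M) := by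
  unfold dirL1
  rw [← blockSites_periodBox L M hL, ← sum_blocks_eq L hL (periodBox M), Finset.mul_sum]
  refine Finset.sum_congr rfl fun z _ => ?_
  have hE : ∀ r : Fin d → Fin L, ∑ κ : Fin d, ‖spreadLift L V φ ((L : ℤ) • z + boxVec L r) κ‖
      = ∑ κ : Fin d, (if ((r κ : ℕ) : ℤ) = (L : ℤ) - 1 then ‖φ z κ‖ else 0) := by
    intro r
    refine Finset.sum_congr rfl fun κ _ => ?_
    rw [norm_spreadLift_eq L hV, cdiv_smul_add_boxVec]
    simp only [isCross_smul_add_boxVec_iff]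
  simp_rw [hE]
  rw [Finset.sum_comm]
  simp_rw [sum_sliceInd hL]
  rw [← Finset.mul_sum]

/-! ## §2 Coarse counting: pairs over planes, periodic shifts -/

omit [Fintype n] [DecidableEq n] in
/-- `Σ_{π = (μ<ν)} (h μ + h ν) ≤ 2d·Σ_κ h κ` for `h ≥ 0`. [folklore] -/
theorem sum_plane_pair_le {h : Fin d → ℝ} (hh : ∀ i, 0 ≤ h i) :
    ∑ π : T4AveragingDeficitWall.Plane d, (h π.1.1 + h π.1.2) ≤ 2 * d * ∑ κ, h κ := by
  classical
  have hE : ∑ π : T4AveragingDeficitWall.Plane d, (h π.1.1 + h π.1.2)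
      = ∑ a ∈ (Finset.univ : Finset (Fin d × Fin d)).filter (fun a => a.1 < a.2), (h a.1 + h a.2) :=
    (Finset.sum_subtype ((Finset.univ : Finset (Fin d × Fin d)).filter (fun a => a.1 < a.2)) (by simp)
      (fun a : Fin d × Fin d => h a.1 + h a.2)).symm
  rw [hE]
  calc ∑ a ∈ (Finset.univ : Finset (Fin d × Fin d)).filter (fun a => a.1 < a.2), (h a.1 + h a.2)
      ≤ ∑ a : Fin d × Fin d, (h a.1 + h a.2) :=
        Finset.sum_le_sum_of_subset_of_nonneg (Finset.filter_subset _ _) fun a _ _ => add_nonneg (hh _) (hh _)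
    _ = 2 * d * ∑ κ, h κ := by
        rw [Fintype.sum_prod_type]
        simp only [Finset.sum_add_distrib, Finset.sum_const, Finset.card_univ, Fintype.card_fin, nsmul_eq_mul]
        rw [← Finset.mul_sum]
        ring

/-- **`Σ_{z∈period} Σ_π G(z,π)² ≤ 16·d·dirSq φ`** for an `M`-periodic `φ`, where `G(z; μ,ν) = ‖φ z μ‖ + ‖φ (z+e_μ) ν‖ + ‖φ (z+e_ν) μ‖ + ‖φ z ν‖`.
[folklore] -/
theorem sum_fourNorm_sq_le {M : ℕ} (hM : 1 ≤ M) {φ : Site d → Fin d → Matrix n n ℂ} (hφ : IsPeriodicDir φ (M : ℤ)) :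
    ∑ z ∈ periodBox M, ∑ π : T4AveragingDeficitWall.Plane d,
        (‖φ z π.1.1‖ + ‖φ (z + e π.1.1) π.1.2‖ + ‖φ (z + e π.1.2) π.1.1‖ + ‖φ z π.1.2‖) ^ 2
      ≤ 16 * d * dirSq φ (periodBox M) := by
  have hshift : ∀ (i j : Fin d), ∑ z ∈ periodBox M, ‖φ (z + e i) j‖ ^ 2 = ∑ z ∈ periodBox M, ‖φ z j‖ ^ 2 :=
    fun i j => sum_periodBox_shift M hM (g := fun z => ‖φ z j‖ ^ 2) (fun x κ => by rw [hφ x κ j]) (e i)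
  have hsq : ∀ (a b c e' : ℝ), (a + b + c + e') ^ 2 ≤ 4 * (a ^ 2 + b ^ 2 + c ^ 2 + e' ^ 2) := fun a b c e' => by
    nlinarith [sq_nonneg (a - b), sq_nonneg (a - c), sq_nonneg (a - e'), sq_nonneg (b - c), sq_nonneg (b - e'), sq_nonneg (c - e')]
  have hH0 : ∀ κ : Fin d, 0 ≤ ∑ z ∈ periodBox M, ‖φ z κ‖ ^ 2 := fun κ => Finset.sum_nonneg fun _ _ => sq_nonneg _
  have hE : ∑ κ : Fin d, ∑ z ∈ periodBox M, ‖φ z κ‖ ^ 2 = dirSq φ (periodBox M) := by unfold dirSq; rw [Finset.sum_comm]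
  rw [Finset.sum_comm]
  calc ∑ π : T4AveragingDeficitWall.Plane d, ∑ z ∈ periodBox M, (‖φ z π.1.1‖ + ‖φ (z + e π.1.1) π.1.2‖ + ‖φ (z + e π.1.2) π.1.1‖ + ‖φ z π.1.2‖) ^ 2
      ≤ ∑ π : T4AveragingDeficitWall.Plane d, ∑ z ∈ periodBox M,
          4 * (‖φ z π.1.1‖ ^ 2 + ‖φ (z + e π.1.1) π.1.2‖ ^ 2 + ‖φ (z + e π.1.2) π.1.1‖ ^ 2 + ‖φ z π.1.2‖ ^ 2) :=
        Finset.sum_le_sum fun π _ => Finset.sum_le_sum fun z _ => hsq _ _ _ _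
    _ = ∑ π : T4AveragingDeficitWall.Plane d, 8 * (∑ z ∈ periodBox M, ‖φ z π.1.1‖ ^ 2 + ∑ z ∈ periodBox M, ‖φ z π.1.2‖ ^ 2) := by
        refine Finset.sum_congr rfl fun π _ => ?_
        rw [← Finset.mul_sum, Finset.sum_add_distrib, Finset.sum_add_distrib, Finset.sum_add_distrib, hshift, hshift]
        ring
    _ ≤ 16 * d * dirSq φ (periodBox M) := by
        rw [← Finset.mul_sum, ← hE]
        have h := sum_plane_pair_le hH0
        linarith

/-- The `ℓ¹` twin: `Σ_{z∈period} Σ_π G(z,π) ≤ 4·d·dirL1 φ`. [folklore] -/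
theorem sum_fourNorm_le {M : ℕ} (hM : 1 ≤ M) {φ : Site d → Fin d → Matrix n n ℂ} (hφ : IsPeriodicDir φ (M : ℤ)) :
    ∑ z ∈ periodBox M, ∑ π : T4AveragingDeficitWall.Plane d, (‖φ z π.1.1‖ + ‖φ (z + e π.1.1) π.1.2‖ + ‖φ (z + e π.1.2) π.1.1‖ + ‖φ z π.1.2‖)
      ≤ 4 * d * dirL1 φ (periodBox M) := by
  have hshift : ∀ (i j : Fin d), ∑ z ∈ periodBox M, ‖φ (z + e i) j‖ = ∑ z ∈ periodBox M, ‖φ z j‖ :=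
    fun i j => sum_periodBox_shift M hM (g := fun z => ‖φ z j‖) (fun x κ => by rw [hφ x κ j]) (e i)
  have hH0 : ∀ κ : Fin d, 0 ≤ ∑ z ∈ periodBox M, ‖φ z κ‖ := fun κ => Finset.sum_nonneg fun _ _ => norm_nonneg _
  have hE : ∑ κ : Fin d, ∑ z ∈ periodBox M, ‖φ z κ‖ = dirL1 φ (periodBox M) := by unfold dirL1; rw [Finset.sum_comm]
  rw [Finset.sum_comm]
  calc ∑ π : T4AveragingDeficitWall.Plane d, ∑ z ∈ periodBox M, (‖φ z π.1.1‖ + ‖φ (z + e π.1.1) π.1.2‖ + ‖φ (z + e π.1.2) π.1.1‖ + ‖φ z π.1.2‖)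
      = ∑ π : T4AveragingDeficitWall.Plane d, 2 * (∑ z ∈ periodBox M, ‖φ z π.1.1‖ + ∑ z ∈ periodBox M, ‖φ z π.1.2‖) := by
        refine Finset.sum_congr rfl fun π _ => ?_
        rw [Finset.sum_add_distrib, Finset.sum_add_distrib, Finset.sum_add_distrib, hshift, hshift]
        ring
    _ ≤ 4 * d * dirL1 φ (periodBox M) := by
        rw [← Finset.mul_sum, ← hE]
        have h := sum_plane_pair_le hH0
        linarith

/-! ## §3 The plaquette majorant and the block sums -/

/-- **THE PLAQUETTE MAJORANT** (files 1∕2 combined): for every fine plaquette `(x; μ, ν)`, `μ ≠ ν`,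
`‖(d_V ψ)(x; μ, ν)‖ ≤ [IsCross x μ ∧ IsCross x ν]·‖(d_{V̄} φ)(cdiv x; μ, ν)‖ + K·G(cdiv x; μ, ν)`, `K = 2((8dL)²a + 12·loopRad)`. [folklore] -/
theorem norm_curlAt_spreadLift_le_majorant [Nonempty n] {L : ℕ} (hL : 1 ≤ L) (hd : 1 ≤ d)
    {V : Site d → Fin d → (Matrix n n ℂ)ˣ} (hV : IsUnitaryCfg V) {a : ℝ} (ha : 0 ≤ a)
    (h512 : 512 * (d + 1) * (d + 4) * (L : ℝ) ^ 2 * a ≤ 1) (hVa : SmallField V a)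
    (φ : Site d → Fin d → Matrix n n ℂ) (x : Site d) {μ ν : Fin d} (hμν : μ ≠ ν) :
    ‖curlAt V (spreadLift L V φ) x μ ν‖
      ≤ (if IsCross L x μ ∧ IsCross L x ν then ‖curlAt (cavg L V) φ (cdiv L x) μ ν‖ else 0)
        + 2 * ((8 * d * L) ^ 2 * a + 12 * loopRad d L a)
          * (‖φ (cdiv L x) μ‖ + ‖φ (cdiv L x + e μ) ν‖ + ‖φ (cdiv L x + e ν) μ‖ + ‖φ (cdiv L x) ν‖) := by
  by_cases h : IsCross L x μ ∧ IsCross L x ν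
  · rw [if_pos h]; exact norm_curlAt_spreadLift_corner_le hL hd hV ha h512 hVa φ hμν h.1 h.2
  · rw [if_neg h, zero_add]
    refine (norm_curlAt_spreadLift_le_of_not_corner hL hd hV ha hVa φ hμν h).trans ?_
    have hw0 : 0 ≤ loopRad d L a := by unfold SpreadLift.loopRad; positivity
    have h1 : 2 * ((3 * (d : ℝ) * L) ^ 2 * a) ≤ 2 * ((8 * d * L) ^ 2 * a + 12 * loopRad d L a) := by
      nlinarith [sq_nonneg ((d : ℝ) * L)]
    have h2 : ‖φ (cdiv L x) μ‖ + ‖φ (cdiv L x) ν‖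
        ≤ ‖φ (cdiv L x) μ‖ + ‖φ (cdiv L x + e μ) ν‖ + ‖φ (cdiv L x + e ν) μ‖ + ‖φ (cdiv L x) ν‖ := by
      linarith [norm_nonneg (φ (cdiv L x + e μ) ν), norm_nonneg (φ (cdiv L x + e ν) μ)]
    exact mul_le_mul h1 h2 (by positivity) (by positivity)

/-- **THE CORNER TERMS SUM TO `L^{d−2}·curlSq (cavg L V) φ`** (`d ≥ 2`, `L ≥ 1`): `L^{d−2}` corner sites per block and plane. [folklore] -/
theorem sum_cornerTerm_sq (hd : 2 ≤ d) {L : ℕ} (hL : 1 ≤ L) (W : Site d → Fin d → (Matrix n n ℂ)ˣ) (M : ℕ)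
    (φ : Site d → Fin d → Matrix n n ℂ) :
    ∑ x ∈ periodBox (L * M), ∑ π : T4AveragingDeficitWall.Plane d,
        (if IsCross L x π.1.1 ∧ IsCross L x π.1.2 then ‖curlAt W φ (cdiv L x) π.1.1 π.1.2‖ else 0) ^ 2
      = (L : ℝ) ^ (d - 2) * curlSq W φ (periodBox M) := by
  obtain ⟨m, rfl⟩ : ∃ m, d = m + 2 := ⟨d - 2, by omega⟩
  unfold curlSq
  rw [← blockSites_periodBox L M hL, ← sum_blocks_eq L hL (periodBox M), Finset.mul_sum]
  refine Finset.sum_congr rfl fun z _ => ?_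
  have hE : ∀ r : Fin (m + 2) → Fin L, ∑ π : T4AveragingDeficitWall.Plane (m + 2),
      (if IsCross L ((L : ℤ) • z + boxVec L r) π.1.1 ∧ IsCross L ((L : ℤ) • z + boxVec L r) π.1.2
        then ‖curlAt W φ (cdiv L ((L : ℤ) • z + boxVec L r)) π.1.1 π.1.2‖ else 0) ^ 2
      = ∑ π : T4AveragingDeficitWall.Plane (m + 2), (if ((r π.1.1 : ℕ) : ℤ) = (L : ℤ) - 1 ∧ ((r π.1.2 : ℕ) : ℤ) = (L : ℤ) - 1
          then ‖curl W φ (z, π)‖ ^ 2 else 0) := by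
    intro r
    refine Finset.sum_congr rfl fun π _ => ?_
    simp only [isCross_smul_add_boxVec_iff, cdiv_smul_add_boxVec, curl]
    split_ifs <;> simp
  simp_rw [hE]
  rw [Finset.sum_comm, Finset.mul_sum]
  refine Finset.sum_congr rfl fun π _ => ?_
  rw [sum_cornerInd hL (ne_of_lt π.2)]
  simp

/-- **THE `O(a)` TERMS**: `Σ_{x∈fine period} Σ_π G(cdiv x, π)² ≤ 16·d·L^d·dirSq φ (periodBox M)` (`M`-periodic `φ`). [folklore] -/
theorem sum_fourNorm_sq_fine_le {L M : ℕ} (hL : 1 ≤ L) (hM : 1 ≤ M) {φ : Site d → Fin d → Matrix n n ℂ}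
    (hφ : IsPeriodicDir φ (M : ℤ)) :
    ∑ x ∈ periodBox (L * M), ∑ π : T4AveragingDeficitWall.Plane d,
        (‖φ (cdiv L x) π.1.1‖ + ‖φ (cdiv L x + e π.1.1) π.1.2‖ + ‖φ (cdiv L x + e π.1.2) π.1.1‖ + ‖φ (cdiv L x) π.1.2‖) ^ 2
      ≤ 16 * d * (L : ℝ) ^ d * dirSq φ (periodBox M) := by
  rw [← blockSites_periodBox L M hL, ← sum_blocks_eq L hL (periodBox M)]
  simp_rw [cdiv_smul_add_boxVec]
  have hE : ∀ z : Site d, ∑ _r : Fin d → Fin L, ∑ π : T4AveragingDeficitWall.Plane d,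
      (‖φ z π.1.1‖ + ‖φ (z + e π.1.1) π.1.2‖ + ‖φ (z + e π.1.2) π.1.1‖ + ‖φ z π.1.2‖) ^ 2
      = (L : ℝ) ^ d * ∑ π : T4AveragingDeficitWall.Plane d, (‖φ z π.1.1‖ + ‖φ (z + e π.1.1) π.1.2‖ + ‖φ (z + e π.1.2) π.1.1‖ + ‖φ z π.1.2‖) ^ 2 := by
    intro z; rw [Finset.sum_const, nsmul_eq_mul, card_offsets_real]
  simp_rw [hE]
  rw [← Finset.mul_sum]
  have h := sum_fourNorm_sq_le hM hφ
  have hLd : 0 ≤ (L : ℝ) ^ d := by positivity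
  nlinarith

/-- The `ℓ¹` twin: `Σ_{x∈fine period} Σ_π G(cdiv x, π) ≤ 4·d·L^d·dirL1 φ (periodBox M)`. [folklore] -/
theorem sum_fourNorm_fine_le {L M : ℕ} (hL : 1 ≤ L) (hM : 1 ≤ M) {φ : Site d → Fin d → Matrix n n ℂ}
    (hφ : IsPeriodicDir φ (M : ℤ)) :
    ∑ x ∈ periodBox (L * M), ∑ π : T4AveragingDeficitWall.Plane d,
        (‖φ (cdiv L x) π.1.1‖ + ‖φ (cdiv L x + e π.1.1) π.1.2‖ + ‖φ (cdiv L x + e π.1.2) π.1.1‖ + ‖φ (cdiv L x) π.1.2‖)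
      ≤ 4 * d * (L : ℝ) ^ d * dirL1 φ (periodBox M) := by
  rw [← blockSites_periodBox L M hL, ← sum_blocks_eq L hL (periodBox M)]
  simp_rw [cdiv_smul_add_boxVec]
  have hE : ∀ z : Site d, ∑ _r : Fin d → Fin L, ∑ π : T4AveragingDeficitWall.Plane d,
      (‖φ z π.1.1‖ + ‖φ (z + e π.1.1) π.1.2‖ + ‖φ (z + e π.1.2) π.1.1‖ + ‖φ z π.1.2‖)
      = (L : ℝ) ^ d * ∑ π : T4AveragingDeficitWall.Plane d, (‖φ z π.1.1‖ + ‖φ (z + e π.1.1) π.1.2‖ + ‖φ (z + e π.1.2) π.1.1‖ + ‖φ z π.1.2‖) := by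
    intro z; rw [Finset.sum_const, nsmul_eq_mul, card_offsets_real]
  simp_rw [hE]
  rw [← Finset.mul_sum]
  have h := sum_fourNorm_le hM hφ
  have hLd : 0 ≤ (L : ℝ) ^ d := by positivity
  nlinarith

omit [Fintype n] [DecidableEq n] in
/-- The constant: `K = 2((8dL)²a + 12·loopRad d L a) ≤ 512(d+4)²L²a`, and `K ≤ 1` under the standard smallness. [folklore] -/
theorem K_le (L : ℕ) {a : ℝ} (ha : 0 ≤ a) :
    2 * ((8 * (d : ℝ) * L) ^ 2 * a + 12 * loopRad d L a) ≤ 512 * ((d : ℝ) + 4) ^ 2 * (L : ℝ) ^ 2 * a := by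
  unfold SpreadLift.loopRad
  nlinarith [sq_nonneg (L : ℝ), mul_nonneg (mul_nonneg (sq_nonneg (L : ℝ)) ha) (by positivity : (0 : ℝ) ≤ (d : ℝ) + 16)]

omit [Fintype n] [DecidableEq n] in
/-- `K ≤ 1` under `512(d+1)(d+4)L²a ≤ 1`. [folklore] -/
theorem K_le_one (L : ℕ) {a : ℝ} (ha : 0 ≤ a) (h512 : 512 * (d + 1) * (d + 4) * (L : ℝ) ^ 2 * a ≤ 1) :
    2 * ((8 * (d : ℝ) * L) ^ 2 * a + 12 * loopRad d L a) ≤ 1 := by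
  unfold SpreadLift.loopRad
  have h0 : 0 ≤ (L : ℝ) ^ 2 * a := by positivity
  nlinarith

/-! ## §4 THE END: the curl energy of the spread lift over one period -/

/-- **(R♯3b) THE CURL OF THE DRESSED (SPREAD) LIFT, `ℓ²` OVER ONE PERIOD.**  For `d ≥ 2`, `L, M ≥ 1`, unitary `V ∈ SmallField V a`
with `0 ≤ a`, `512(d+1)(d+4)L²a ≤ 1`, and an `M`-periodic coarse direction `φ`:
`√(curlSq V (spreadLift L V φ) (periodBox (L·M)))`
`≤ √(L^{d−2})·√(curlSq (cavg L V) φ (periodBox M)) + 2048(d+4)²L²√(d·L^d)·a·√(dirSq φ (periodBox M))`. [folklore] -/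
theorem sqrt_curlSq_spreadLift_le [Nonempty n] (hd : 2 ≤ d) {L M : ℕ} (hL : 1 ≤ L) (hM : 1 ≤ M)
    {V : Site d → Fin d → (Matrix n n ℂ)ˣ} (hV : IsUnitaryCfg V) {a : ℝ} (ha : 0 ≤ a)
    (h512 : 512 * (d + 1) * (d + 4) * (L : ℝ) ^ 2 * a ≤ 1) (hVa : SmallField V a)
    {φ : Site d → Fin d → Matrix n n ℂ} (hφ : IsPeriodicDir φ (M : ℤ)) :
    Real.sqrt (curlSq V (spreadLift L V φ) (periodBox (L * M)))
      ≤ Real.sqrt ((L : ℝ) ^ (d - 2)) * Real.sqrt (curlSq (cavg L V) φ (periodBox M))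
        + 2048 * ((d : ℝ) + 4) ^ 2 * (L : ℝ) ^ 2 * Real.sqrt (d * (L : ℝ) ^ d) * a * Real.sqrt (dirSq φ (periodBox M)) := by
  have hd1 : 1 ≤ d := by omega
  obtain ⟨K, hK⟩ : ∃ K : ℝ, K = 2 * ((8 * (d : ℝ) * L) ^ 2 * a + 12 * loopRad d L a) := ⟨_, rfl⟩
  have hK0 : 0 ≤ K := by rw [hK]; unfold SpreadLift.loopRad; positivity
  set S : Finset (Site d × T4AveragingDeficitWall.Plane d) := periodBox (L * M) ×ˢ (Finset.univ : Finset (T4AveragingDeficitWall.Plane d)) with hS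
  -- the three plaquette functions
  set u : Site d × T4AveragingDeficitWall.Plane d → ℝ := fun p => ‖curl V (spreadLift L V φ) p‖ with hu
  set f : Site d × T4AveragingDeficitWall.Plane d → ℝ := fun p =>
    if IsCross L p.1 p.2.1.1 ∧ IsCross L p.1 p.2.1.2 then ‖curlAt (cavg L V) φ (cdiv L p.1) p.2.1.1 p.2.1.2‖ else 0 with hf
  set g : Site d × T4AveragingDeficitWall.Plane d → ℝ := fun p => K * (‖φ (cdiv L p.1) p.2.1.1‖ + ‖φ (cdiv L p.1 + e p.2.1.1) p.2.1.2‖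
    + ‖φ (cdiv L p.1 + e p.2.1.2) p.2.1.1‖ + ‖φ (cdiv L p.1) p.2.1.2‖) with hg
  have hcurlSq : curlSq V (spreadLift L V φ) (periodBox (L * M)) = ∑ p ∈ S, u p ^ 2 := by
    unfold curlSq; rw [hS, Finset.sum_product]
  have hmaj : ∀ p ∈ S, u p ≤ f p + g p := fun p _ => by
    have h := norm_curlAt_spreadLift_le_majorant hL hd1 hV ha h512 hVa φ p.1 (ne_of_lt p.2.2)
    rw [← hK] at h
    exact h
  have hfS : ∑ p ∈ S, f p ^ 2 = (L : ℝ) ^ (d - 2) * curlSq (cavg L V) φ (periodBox M) := by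
    rw [hS, Finset.sum_product]; exact sum_cornerTerm_sq hd hL (cavg L V) M φ
  have hgS : ∑ p ∈ S, g p ^ 2 ≤ K ^ 2 * (16 * d * (L : ℝ) ^ d * dirSq φ (periodBox M)) := by
    rw [hS, Finset.sum_product]
    have h := sum_fourNorm_sq_fine_le (d := d) hL hM hφ
    have hE : ∀ p : Site d × T4AveragingDeficitWall.Plane d, g p ^ 2 = K ^ 2 * (‖φ (cdiv L p.1) p.2.1.1‖ + ‖φ (cdiv L p.1 + e p.2.1.1) p.2.1.2‖
        + ‖φ (cdiv L p.1 + e p.2.1.2) p.2.1.1‖ + ‖φ (cdiv L p.1) p.2.1.2‖) ^ 2 := fun p => by rw [hg]; ring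
    simp_rw [hE, ← Finset.mul_sum]
    exact mul_le_mul_of_nonneg_left h (sq_nonneg K)
  -- Minkowski
  have h1 : Real.sqrt (∑ p ∈ S, u p ^ 2) ≤ Real.sqrt (∑ p ∈ S, (f p + g p) ^ 2) :=
    sqrt_sum_sq_mono S (fun p _ => norm_nonneg _) hmaj
  have h2 := sqrt_sum_sq_add_le S f g
  have h3 : Real.sqrt (∑ p ∈ S, f p ^ 2) = Real.sqrt ((L : ℝ) ^ (d - 2)) * Real.sqrt (curlSq (cavg L V) φ (periodBox M)) := by
    rw [hfS, Real.sqrt_mul (by positivity)]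
  have hD0 : 0 ≤ dirSq φ (periodBox M) := Finset.sum_nonneg fun _ _ => Finset.sum_nonneg fun _ _ => sq_nonneg _
  have h4 : Real.sqrt (∑ p ∈ S, g p ^ 2) ≤ K * (4 * Real.sqrt (d * (L : ℝ) ^ d)) * Real.sqrt (dirSq φ (periodBox M)) := by
    have hB0 : 0 ≤ K * (4 * Real.sqrt (d * (L : ℝ) ^ d)) * Real.sqrt (dirSq φ (periodBox M)) := by positivity
    rw [← Real.sqrt_sq hB0]
    refine Real.sqrt_le_sqrt (hgS.trans (le_of_eq ?_))
    have hs1 : Real.sqrt ((d : ℝ) * (L : ℝ) ^ d) ^ 2 = (d : ℝ) * (L : ℝ) ^ d := Real.sq_sqrt (by positivity)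
    have hs2 : Real.sqrt (dirSq φ (periodBox M)) ^ 2 = dirSq φ (periodBox M) := Real.sq_sqrt hD0
    have hx : (K * (4 * Real.sqrt (d * (L : ℝ) ^ d)) * Real.sqrt (dirSq φ (periodBox M))) ^ 2
        = K ^ 2 * (16 * Real.sqrt ((d : ℝ) * (L : ℝ) ^ d) ^ 2 * Real.sqrt (dirSq φ (periodBox M)) ^ 2) := by ring
    rw [hx, hs1, hs2]
    ring
  have h5 : K * (4 * Real.sqrt (d * (L : ℝ) ^ d)) ≤ 2048 * ((d : ℝ) + 4) ^ 2 * (L : ℝ) ^ 2 * Real.sqrt (d * (L : ℝ) ^ d) * a := by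
    have hK1 := K_le (d := d) L ha
    have hs0 : 0 ≤ Real.sqrt ((d : ℝ) * (L : ℝ) ^ d) := Real.sqrt_nonneg _
    nlinarith [mul_le_mul_of_nonneg_right hK1 hs0]
  have hSq0 : 0 ≤ Real.sqrt (dirSq φ (periodBox M)) := Real.sqrt_nonneg _
  rw [hcurlSq]
  calc Real.sqrt (∑ p ∈ S, u p ^ 2) ≤ Real.sqrt (∑ p ∈ S, f p ^ 2) + Real.sqrt (∑ p ∈ S, g p ^ 2) := h1.trans h2
    _ ≤ Real.sqrt ((L : ℝ) ^ (d - 2)) * Real.sqrt (curlSq (cavg L V) φ (periodBox M))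
        + K * (4 * Real.sqrt (d * (L : ℝ) ^ d)) * Real.sqrt (dirSq φ (periodBox M)) := by rw [h3]; linarith
    _ ≤ _ := by nlinarith [mul_le_mul_of_nonneg_right h5 hSq0]

/-- **(R♯3b, `ℓ¹` companion) `curlL1 V (spreadLift L V φ) (periodBox (L·M)) ≤ 8·d·L^d·dirL1 φ (periodBox M)`** under the same
hypotheses (`‖(d_{V̄}φ)(z;π)‖ ≤ G(z,π)` for the unitary `V̄ = cavg L V`, `K ≤ 1`). [folklore] -/
theorem curlL1_spreadLift_le [Nonempty n] (hd : 2 ≤ d) {L M : ℕ} (hL : 1 ≤ L) (hM : 1 ≤ M)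
    {V : Site d → Fin d → (Matrix n n ℂ)ˣ} (hV : IsUnitaryCfg V) {a : ℝ} (ha : 0 ≤ a)
    (h512 : 512 * (d + 1) * (d + 4) * (L : ℝ) ^ 2 * a ≤ 1) (hVa : SmallField V a)
    {φ : Site d → Fin d → Matrix n n ℂ} (hφ : IsPeriodicDir φ (M : ℤ)) :
    curlL1 V (spreadLift L V φ) (periodBox (L * M)) ≤ 8 * d * (L : ℝ) ^ d * dirL1 φ (periodBox M) := by
  have hd1 : 1 ≤ d := by omega
  have hK1 := K_le_one (d := d) L ha h512
  have hW : IsUnitaryCfg (cavg L V) := fun y κ => cavg_mem hL hV ha h512 hVa y κ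
  have hpt : ∀ (x : Site d) (π : T4AveragingDeficitWall.Plane d), ‖curl V (spreadLift L V φ) (x, π)‖
      ≤ 2 * (‖φ (cdiv L x) π.1.1‖ + ‖φ (cdiv L x + e π.1.1) π.1.2‖ + ‖φ (cdiv L x + e π.1.2) π.1.1‖ + ‖φ (cdiv L x) π.1.2‖) := by
    intro x π
    have h := norm_curlAt_spreadLift_le_majorant hL hd1 hV ha h512 hVa φ x (ne_of_lt π.2)
    have hG0 : 0 ≤ ‖φ (cdiv L x) π.1.1‖ + ‖φ (cdiv L x + e π.1.1) π.1.2‖ + ‖φ (cdiv L x + e π.1.2) π.1.1‖ + ‖φ (cdiv L x) π.1.2‖ := by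
      positivity
    have hc : (if IsCross L x π.1.1 ∧ IsCross L x π.1.2 then ‖curlAt (cavg L V) φ (cdiv L x) π.1.1 π.1.2‖ else 0)
        ≤ ‖φ (cdiv L x) π.1.1‖ + ‖φ (cdiv L x + e π.1.1) π.1.2‖ + ‖φ (cdiv L x + e π.1.2) π.1.1‖ + ‖φ (cdiv L x) π.1.2‖ := by
      split_ifs
      · exact norm_curl_le_four hW φ (cdiv L x) π
      · exact hG0
    have hKG := mul_le_mul_of_nonneg_right hK1 hG0
    change ‖curlAt V (spreadLift L V φ) x π.1.1 π.1.2‖ ≤ _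
    linarith
  unfold curlL1
  calc ∑ x ∈ periodBox (L * M), ∑ π : T4AveragingDeficitWall.Plane d, ‖curl V (spreadLift L V φ) (x, π)‖
      ≤ ∑ x ∈ periodBox (L * M), ∑ π : T4AveragingDeficitWall.Plane d,
          2 * (‖φ (cdiv L x) π.1.1‖ + ‖φ (cdiv L x + e π.1.1) π.1.2‖ + ‖φ (cdiv L x + e π.1.2) π.1.1‖ + ‖φ (cdiv L x) π.1.2‖) :=
        Finset.sum_le_sum fun x _ => Finset.sum_le_sum fun π _ => hpt x π
    _ ≤ 8 * d * (L : ℝ) ^ d * dirL1 φ (periodBox M) := by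
        simp_rw [← Finset.mul_sum]
        have h := sum_fourNorm_fine_le (d := d) hL hM hφ
        linarith

end

end Summit.QuantumFields.BalabanUV.T4Continuum.NE3SpreadLiftCurl
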